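import Mathlib
import Summits.KontsevichZagierPeriods.Zeta5Search.Certificates.RecordRayConnection
import Summits.KontsevichZagierPeriods.Zeta5Search.Certificates.RecordRayGenericSteps
import HarnessLib

/-!
# The closed-form steps at affine points of the record ray (fam-tele g15, S4-R1 file 2c)

HONEST FRAMING: systematic search; no irrationality claim unless certified.  Exact algebra about the coefficient
frame `T(b)` (`RecordRayConnection.frameMat`); nothing here evaluates a linear form, `ζ(5)` or a denominator.

The four closed-form steps of `RecordRayConnection` (RAISE₇, RAISE_{i+1}, DS, H — each a tree theorem:
`fourTerm_coeff_rel_UWV`, `CFW3.coeff_contiguity`, `dictionary_dsShift7`, `dictRaise_at`) are restated at an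
AFFINE POINT `rayPt β n = n·(41;17,…,11) + β` of the record ray, with all their side conditions (box, `d ≥ 3`,
slot order, `b₇ + 3 ≤ b₀`, `b₀ ≥ 1`) discharged for EVERY `n ≥ 1` from one Boolean check on the offsets `β`
(an affine form `u·n + v` is `≥ 0` for all `n ≥ 1` iff `u ≥ 0` and `u + v ≥ 0`; fam-tele g14 `conn/window.py (e)`):
* `lower_step`, `ds_step`, `h_step` — `S̃(p)·T(p) = σ(p)·T(p′)` with `S̃` the GENERIC step matrix of
  `RecordRayGenericSteps` read at `ν = n` (it IS the tree's matrix there: `raiseMatG_castPt` …) and `p′` the next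
  affine point (identified slotwise on `b₀…b₇`, which is all `frameMat` sees: `frameMat_congr`);
* the non-vanishing of the step scalars `γ₃(p) = 1 − d(p)` and `det hScale(z)` and of `det T(p) = cas3(p)`
  (`cas3_ne_zero`) at checked points.
-/

namespace Summit.KontsevichZagierPeriods.Zeta5Search.RecordRay.Generic

open Finset Matrix
open Summit.KontsevichZagierPeriods.Zeta5Search.DualSeries (InBox)
open Summit.KontsevichZagierPeriods.Zeta5Search.WedgeDictionary
open Summit.KontsevichZagierPeriods.Zeta5Search.Elimination
open Summit.KontsevichZagierPeriods.Zeta5Search.DualSeriesLemma19 (coeffV_congr')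
open Summit.KontsevichZagierPeriods.Zeta5Search.RecordRay.Connection

/-! ### 1. At an integer point the generic step matrices are the tree's -/

section CastPt
variable (b : ℕ → ℤ)

/-- `kapG` at the cast of an integer point is the cast of its integer value. -/
theorem kapG_castPt (i : ℕ) : kapG (castPt b) i = kap b i := rfl

/-- `raise7MatG` at the cast of an integer point is the cast of its integer value. -/
theorem raise7MatG_castPt : raise7MatG (castPt b) = raise7Mat b := rfl

/-- `raiseMatG` at the cast of an integer point is the cast of its integer value. -/
theorem raiseMatG_castPt (i : ℕ) : raiseMatG (castPt b) i = raiseMat b i := by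
  simp only [raiseMatG, raiseMat, bumpG_castPt, kapG_castPt, topGamma0G_castPt, topGamma1G_castPt,
    topGamma2G_castPt, topGamma3G_castPt]

/-- `dsMatG` at the cast of an integer point is the cast of its integer value. -/
theorem dsMatG_castPt : dsMatG (castPt b) = dsMat b := by
  simp only [dsMatG, dsMat, bumpG_castPt, dsLamG_castPt, topGamma0G_castPt, topGamma1G_castPt,
    topGamma2G_castPt, topGamma3G_castPt]

/-- `hMatG` at the cast of an integer point is the cast of its integer value. -/
theorem hMatG_castPt : hMatG (castPt b) = hMat b := by
  simp only [hMatG, hMat, bumpG_castPt, raiseTh1G_castPt, raiseTh2G_castPt, raiseTh3G_castPt,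
    topGamma0G_castPt, topGamma1G_castPt, topGamma2G_castPt, topGamma3G_castPt]

/-- `hScaleG` at the cast of an integer point is the cast of its integer value. -/
theorem hScaleG_castPt : hScaleG (castPt b) = hScale b := by
  simp only [hScaleG, hScale, bumpG_castPt, raisePrG_castPt, topGamma3G_castPt]

end CastPt

/-- `frameMat b` only sees the slots `b₀,…,b₇` (`coeffU/W/V` depend on `b₀` and `numPoly b`). -/
theorem frameMat_congr {b b' : ℕ → ℤ} (h : ∀ j, j ≤ 7 → b j = b' j) : frameMat b = frameMat b' := by
  have hb : ∀ {c c' : ℕ → ℤ}, (∀ j, j ≤ 7 → c j = c' j) → ∀ j, j ≤ 7 → bump c 6 j = bump c' 6 j := by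
    intro c c' hc j hj
    by_cases h7 : j = 7
    · subst h7; simp [bump, hc 7 le_rfl]
    · simp [bump, h7, hc j hj]
  have e : ∀ {c c' : ℕ → ℤ}, (∀ j, j ≤ 7 → c j = c' j) →
      coeffU c = coeffU c' ∧ coeffW c = coeffW c' ∧ coeffV c = coeffV c' := fun hc =>
    ⟨coeffU_congr' (hc 0 (by norm_num)) (numPoly_congr hc), coeffW_congr' (hc 0 (by norm_num)) (numPoly_congr hc),
      coeffV_congr' (hc 0 (by norm_num)) (numPoly_congr hc)⟩
  obtain ⟨u0, w0, v0⟩ := e h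
  obtain ⟨u1, w1, v1⟩ := e (hb h)
  obtain ⟨u2, w2, v2⟩ := e (hb (hb h))
  simp only [frameMat, u0, w0, v0, u1, w1, v1, u2, w2, v2]

/-! ### 2. Affine side conditions, checked once for all `n ≥ 1` -/

/-- `u·n + v ≥ 0` for every `n ≥ 1`. -/
def affOK (u v : ℤ) : Bool := decide (0 ≤ u) && decide (0 ≤ u + v)

/-- Soundness of the Boolean side-condition checker `affOK`: a passed check gives the arithmetic facts. -/
theorem affOK_sound {u v : ℤ} (h : affOK u v = true) {n : ℕ} (hn : 1 ≤ n) : 0 ≤ u * (n : ℤ) + v := by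
  simp only [affOK, Bool.and_eq_true, decide_eq_true_eq] at h
  have h1 : (1 : ℤ) ≤ n := by exact_mod_cast hn
  nlinarith [h.1, h.2]

/-- `β₁ + ⋯ + β₇`. -/
def bsum7 (β : List ℤ) : ℤ :=
  β.getD 1 0 + β.getD 2 0 + β.getD 3 0 + β.getD 4 0 + β.getD 5 0 + β.getD 6 0 + β.getD 7 0

/-- The point check: `b₀ ≥ 1`, `d ≥ 3`, `b₇ + 3 ≤ b₀`, `0 ≤ b_j ≤ b₀` (`j = 1..7`) at `rayPt β n` for all `n ≥ 1`. -/
def ptChk (β : List ℤ) : Bool :=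
  affOK 41 (β.getD 0 0 - 1) && affOK 25 (3 * β.getD 0 0 - bsum7 β - 3) && affOK 30 (β.getD 0 0 - β.getD 7 0 - 3) &&
    (List.range 7).all fun j =>
      affOK (rayDir.getD (j + 1) 0) (β.getD (j + 1) 0) &&
        affOK (41 - rayDir.getD (j + 1) 0) (β.getD 0 0 - β.getD (j + 1) 0)

/-- Slot `0` of the ray point. -/
theorem rayPt_zero (β : List ℤ) (n : ℕ) : rayPt β n 0 = 41 * n + β.getD 0 0 := by simp [rayPt, rayDir]

/-- Slot `7` of the ray point. -/
theorem rayPt_seven (β : List ℤ) (n : ℕ) : rayPt β n 7 = 11 * n + β.getD 7 0 := by simp [rayPt, rayDir]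

/-- The interior slots of the ray point. -/
theorem rayPt_succ (β : List ℤ) (n j : ℕ) : rayPt β n (j + 1) = rayDir.getD (j + 1) 0 * n + β.getD (j + 1) 0 :=
  rfl

/-- `d` of the ray point. -/
theorem dOf_rayPt (β : List ℤ) (n : ℕ) : dOf (rayPt β n) = 25 * n + (3 * β.getD 0 0 - bsum7 β) := by
  simp [dOf, rayPt, rayDir, bsum7, sum_range_succ]
  ring

/-- The side conditions every step lemma needs, at `rayPt β n` for every `n ≥ 1`: box, `d ≥ 3`, slot order,
`b₇ + 3 ≤ b₀`, `b₀ ≥ 1`. -/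
theorem ptChk_sound {β : List ℤ} (h : ptChk β = true) {n : ℕ} (hn : 1 ≤ n) :
    InBox (rayPt β n) ∧ 3 ≤ dOf (rayPt β n) ∧ (∀ i, i < 7 → rayPt β n (i + 1) ≤ rayPt β n 0) ∧
      rayPt β n 7 + 3 ≤ rayPt β n 0 ∧ 1 ≤ (rayPt β n 0).toNat := by
  simp only [ptChk, Bool.and_eq_true, List.all_eq_true, List.mem_range] at h
  obtain ⟨⟨⟨h0, hd⟩, h7⟩, hall⟩ := h
  have e0 := rayPt_zero β n
  have e7 := rayPt_seven β n
  have A0 := affOK_sound h0 hn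
  have Ad := affOK_sound hd hn
  have A7 := affOK_sound h7 hn
  have AS : ∀ j, j < 7 → 0 ≤ rayDir.getD (j + 1) 0 * (n : ℤ) + β.getD (j + 1) 0 ∧
      0 ≤ (41 - rayDir.getD (j + 1) 0) * (n : ℤ) + (β.getD 0 0 - β.getD (j + 1) 0) :=
    fun j hj => ⟨affOK_sound (hall j hj).1 hn, affOK_sound (hall j hj).2 hn⟩
  unfold InBox
  refine ⟨⟨by rw [e0]; linarith, fun j hj => ?_⟩, ?_, fun i hi => ?_, ?_, ?_⟩
  · obtain ⟨a1, a2⟩ := AS j (mem_range.1 hj)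
    rw [rayPt_succ, e0]
    constructor <;> linarith
  · rw [dOf_rayPt]; linarith
  · obtain ⟨_, a2⟩ := AS i hi
    rw [rayPt_succ, e0]; linarith
  · rw [e7, e0]; linarith
  · rw [e0]; omega

/-- Pair sums `b_j + b_k ≤ b₀` (for `cas3_ne_zero`). -/
def pairChk (β : List ℤ) : Bool :=
  allPairs.all fun jk =>
    affOK (41 - rayDir.getD jk.1 0 - rayDir.getD jk.2 0) (β.getD 0 0 - β.getD jk.1 0 - β.getD jk.2 0)

/-- Soundness of the pair checker: a passed check gives the slot inequalities it encodes. -/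
theorem pairChk_sound {β : List ℤ} (h : pairChk β = true) {n : ℕ} (hn : 1 ≤ n) :
    ∀ jk ∈ allPairs, rayPt β n jk.1 + rayPt β n jk.2 ≤ rayPt β n 0 := by
  intro jk hjk
  have A := affOK_sound (List.all_eq_true.1 h jk hjk) hn
  have e1 : rayPt β n jk.1 = rayDir.getD jk.1 0 * n + β.getD jk.1 0 := rfl
  have e2 : rayPt β n jk.2 = rayDir.getD jk.2 0 * n + β.getD jk.2 0 := rfl
  rw [e1, e2, rayPt_zero]; linarith

/-- The six factors of `raisePr` are positive: `b_j + b_k ≤ b₀` for `j < k` in `{1,2,3,6}`. -/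
def prChk (β : List ℤ) : Bool :=
  [(1, 2), (1, 3), (1, 6), (2, 3), (2, 6), (3, 6)].all fun jk : ℕ × ℕ =>
    affOK (41 - rayDir.getD jk.1 0 - rayDir.getD jk.2 0) (β.getD 0 0 - β.getD jk.1 0 - β.getD jk.2 0)

/-- The factorial-type factors met along the ray are positive. -/
private theorem fac_pos {b : ℕ → ℤ} {j k : ℕ} (h : b j + b k ≤ b 0) : (0 : ℚ) < (b 0 : ℚ) + 1 - b j - b k := by
  have : ((b j + b k : ℤ) : ℚ) ≤ (b 0 : ℚ) := by exact_mod_cast h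
  push_cast at this; linarith

/-- The raising prefactor does not vanish at a checked point. -/
theorem raisePr_ne {β : List ℤ} (h : prChk β = true) {n : ℕ} (hn : 1 ≤ n) : raisePr (rayPt β n) ≠ 0 := by
  have A : ∀ jk ∈ [((1 : ℕ), (2 : ℕ)), (1, 3), (1, 6), (2, 3), (2, 6), (3, 6)],
      rayPt β n jk.1 + rayPt β n jk.2 ≤ rayPt β n 0 := by
    intro jk hjk
    have a := affOK_sound (List.all_eq_true.1 h jk hjk) hn
    have e1 : rayPt β n jk.1 = rayDir.getD jk.1 0 * n + β.getD jk.1 0 := rfl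
    have e2 : rayPt β n jk.2 = rayDir.getD jk.2 0 * n + β.getD jk.2 0 := rfl
    rw [e1, e2, rayPt_zero]; linarith
  have f12 := fac_pos (A (1, 2) (by simp))
  have f13 := fac_pos (A (1, 3) (by simp))
  have f16 := fac_pos (A (1, 6) (by simp))
  have f23 := fac_pos (A (2, 3) (by simp))
  have f26 := fac_pos (A (2, 6) (by simp))
  have f36 := fac_pos (A (3, 6) (by simp))
  unfold raisePr
  exact mul_ne_zero (mul_ne_zero (mul_ne_zero (mul_ne_zero (mul_ne_zero f12.ne' f13.ne') f16.ne') f23.ne')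
    f26.ne') f36.ne'

/-! ### 3. The next point, slotwise -/

/-- `β′ = β + e_{i+1}` on the slots `0..7`. -/
def bumpTgt (β β' : List ℤ) (i : ℕ) : Bool :=
  (List.range 8).all fun j => decide (β'.getD j 0 = if j = i + 1 then β.getD j 0 + 1 else β.getD j 0)

/-- `β′ = β + (2;1,…,1)` on the slots `0..7`. -/
def dsTgt (β β' : List ℤ) : Bool :=
  (List.range 8).all fun j => decide (β'.getD j 0 = if j = 0 then β.getD j 0 + 2 else β.getD j 0 + 1)

/-- `β′ = β + 1_{0,4,5,7}` on the slots `0..7`. -/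
def hTgt (β β' : List ℤ) : Bool :=
  (List.range 8).all fun j =>
    decide (β'.getD j 0 = if j = 0 ∨ j = 4 ∨ j = 5 ∨ j = 7 then β.getD j 0 + 1 else β.getD j 0)

/-- At a checked integer point the generic raising matrix specialises to the tree's raising step. -/
theorem bump_agree {β β' : List ℤ} {i : ℕ} (h : bumpTgt β β' i = true) (n : ℕ) :
    ∀ j, j ≤ 7 → bump (rayPt β n) i j = rayPt β' n j := by
  intro j hj
  have e := List.all_eq_true.1 h j (List.mem_range.2 (by omega))
  simp only [decide_eq_true_eq] at e
  by_cases hji : j = i + 1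
  · subst hji
    simp only [bump, Function.update_self, rayPt, e, if_true]; ring
  · rw [bump, Function.update_of_ne hji]
    simp only [rayPt, e, hji, if_false]

/-- At a checked integer point the generic diagonal-shift matrix specialises to the tree's DS step. -/
theorem ds_agree {β β' : List ℤ} (h : dsTgt β β' = true) (n : ℕ) :
    ∀ j, j ≤ 7 → dsShift (rayPt β n) j = rayPt β' n j := by
  intro j hj
  have e := List.all_eq_true.1 h j (List.mem_range.2 (by omega))
  simp only [decide_eq_true_eq] at e
  by_cases hj0 : j = 0
  · subst hj0; simp only [dsShift, rayPt, e, if_true]; ring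
  · simp only [dsShift, rayPt, e, hj0, if_false]; ring

/-- At a checked integer point the generic `H` matrix specialises to the tree's `H` step. -/
theorem h_agree {β β' : List ℤ} (h : hTgt β β' = true) (n : ℕ) :
    ∀ j, j ≤ 7 → hShift (rayPt β n) j = rayPt β' n j := by
  intro j hj
  have e := List.all_eq_true.1 h j (List.mem_range.2 (by omega))
  simp only [decide_eq_true_eq] at e
  by_cases hj0 : j = 0 ∨ j = 4 ∨ j = 5 ∨ j = 7
  · simp only [hShift, rayPt, e, hj0, if_true]; ring
  · simp only [hShift, rayPt, e, hj0, if_false]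

/-! ### 4. The steps at affine points, for every `n ≥ 1` -/

/-- RAISE in lattice slot `i+1 ≤ 7`: point check, slot, and target. -/
def lowerChk (β β' : List ℤ) (i : ℕ) : Bool := ptChk β && decide (i ≤ 6) && bumpTgt β β' i
/-- DS: point check and target. -/
def dsChk (β β' : List ℤ) : Bool := ptChk β && dsTgt β β'
/-- H: point check, `pr ≠ 0`, and target. -/
def hChk (β β' : List ℤ) : Bool := ptChk β && prChk β && hTgt β β'

/-- A passed lowering check contains the point check. -/
theorem ptChk_of_lowerChk {β β' : List ℤ} {i : ℕ} (h : lowerChk β β' i = true) : ptChk β = true := by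
  simp only [lowerChk, Bool.and_eq_true] at h; exact h.1.1

/-- A passed DS check contains the point check. -/
theorem ptChk_of_dsChk {β β' : List ℤ} (h : dsChk β β' = true) : ptChk β = true := by
  simp only [dsChk, Bool.and_eq_true] at h; exact h.1

/-- A passed `H` check contains the point check. -/
theorem ptChk_of_hChk {β β' : List ℤ} (h : hChk β β' = true) : ptChk β = true := by
  simp only [hChk, Bool.and_eq_true] at h; exact h.1.1

/-- A passed `H` check contains the prefactor check. -/
theorem prChk_of_hChk {β β' : List ℤ} (h : hChk β β' = true) : prChk β = true := by
  simp only [hChk, Bool.and_eq_true] at h; exact h.1.2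

/-- **RAISE at an affine point.** `R̃_{i+1}(p)·T(p) = γ₃(p)·T(p + e_{i+1})`, `p = rayPt β n`, all `n ≥ 1`. -/
theorem lower_step {β β' : List ℤ} {i : ℕ} (h : lowerChk β β' i = true) {n : ℕ} (hn : 1 ≤ n) :
    lowerMatG (rayPtG β (n : ℚ)) i * frameMat (rayPt β n) =
      topGamma3G (rayPtG β (n : ℚ)) • frameMat (rayPt β' n) := by
  simp only [lowerChk, Bool.and_eq_true, decide_eq_true_eq] at h
  obtain ⟨⟨hp, hi⟩, ht⟩ := h
  obtain ⟨Pbox, Pd, Pslot, P7, P1⟩ := ptChk_sound hp hn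
  rw [← castPt_rayPt, topGamma3G_castPt, ← frameMat_congr (bump_agree ht n)]
  unfold lowerMatG
  split_ifs with h6
  · subst h6
    rw [raise7MatG_castPt]
    exact raise7Mat_mul_frameMat _ Pbox (by linarith) (by linarith)
  · rw [raiseMatG_castPt]
    exact raiseMat_mul_frameMat _ Pbox (by linarith) (mem_range.2 (by omega)) (Pslot i (by omega)) (by linarith) P1

/-- **DS at an affine point.** `D̃S(p)·T(p) = γ₃(p)·T(p⁺)`. -/
theorem ds_step {β β' : List ℤ} (h : dsChk β β' = true) {n : ℕ} (hn : 1 ≤ n) :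
    dsMatG (rayPtG β (n : ℚ)) * frameMat (rayPt β n) = topGamma3G (rayPtG β (n : ℚ)) • frameMat (rayPt β' n) := by
  simp only [dsChk, Bool.and_eq_true] at h
  obtain ⟨hp, ht⟩ := h
  obtain ⟨Pbox, Pd, -, P7, -⟩ := ptChk_sound hp hn
  rw [← castPt_rayPt, topGamma3G_castPt, dsMatG_castPt, ← frameMat_congr (ds_agree ht n)]
  exact dsMat_mul_frameMat _ Pbox (by linarith) (by linarith)

/-- **H at an affine point.** `H̃(z)·T(z) = det(hScale z)·T(Hz)` with `H̃ = adj(hScale)·hMat`. -/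
theorem h_step {β β' : List ℤ} (h : hChk β β' = true) {n : ℕ} (hn : 1 ≤ n) :
    hTildeG (rayPtG β (n : ℚ)) * frameMat (rayPt β n) =
      (hScaleG (rayPtG β (n : ℚ))).det • frameMat (rayPt β' n) := by
  have hp := ptChk_of_hChk h
  simp only [hChk, Bool.and_eq_true] at h
  obtain ⟨_, ht⟩ := h
  obtain ⟨Pbox, Pd, -, P7, -⟩ := ptChk_sound hp hn
  rw [← castPt_rayPt, hTildeG, hScaleG_castPt, hMatG_castPt, ← frameMat_congr (h_agree ht n), Matrix.mul_assoc,
    hMat_mul_frameMat _ Pbox Pd P7, ← Matrix.mul_assoc, Matrix.adjugate_mul, smul_mul_assoc, Matrix.one_mul]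

/-! ### 5. Non-vanishing of the step scalars and of `det T` at checked points -/

/-- `topGamma3` does not vanish under the slot inequality. -/
theorem topGamma3_ne_of_le {b : ℕ → ℤ} (hd : 3 ≤ dOf b) : topGamma3 b ≠ 0 := by
  rw [topGamma3_eq]
  have : (3 : ℚ) ≤ (dOf b : ℚ) := by exact_mod_cast hd
  intro h0; linarith

/-- `topGamma3` does not vanish at a checked point. -/
theorem gamma3_ne {β : List ℤ} (hp : ptChk β = true) {n : ℕ} (hn : 1 ≤ n) : topGamma3G (rayPtG β (n : ℚ)) ≠ 0 := by
  rw [← castPt_rayPt, topGamma3G_castPt]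
  exact topGamma3_ne_of_le (ptChk_sound hp hn).2.1

/-- The `H`-scaling matrix is invertible at a checked point. -/
theorem hScale_det_ne {β : List ℤ} (hp : ptChk β = true) (hq : prChk β = true) {n : ℕ} (hn : 1 ≤ n) :
    (hScaleG (rayPtG β (n : ℚ))).det ≠ 0 := by
  rw [← castPt_rayPt, hScaleG_castPt]
  have Pd := (ptChk_sound hp hn).2.1
  have hpr : raisePr (rayPt β n) ≠ 0 := raisePr_ne hq hn
  have hpr1 : raisePr (bump (rayPt β n) 6) = raisePr (rayPt β n) := by simp [raisePr, bump]
  have hpr2 : raisePr (bump (bump (rayPt β n) 6) 6) = raisePr (rayPt β n) := by simp [raisePr, bump]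
  have hg0 : topGamma3 (rayPt β n) ≠ 0 := topGamma3_ne_of_le Pd
  have hg1 : topGamma3 (bump (rayPt β n) 6) ≠ 0 := by
    rw [topGamma3_eq, dOf_bump _ (mem_range.2 (by norm_num))]
    have : (3 : ℚ) ≤ (dOf (rayPt β n) : ℚ) := by exact_mod_cast Pd
    push_cast; intro h0; linarith
  rw [Matrix.det_fin_three]
  simp [hScale, hpr1, hpr2, hpr, hg0, hg1]

/-- The coefficient frame is invertible at a checked point. -/
theorem frameMat_det_ne {β : List ℤ} (hp : ptChk β = true) (hpair : pairChk β = true) {n : ℕ} (hn : 1 ≤ n) :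
    (frameMat (rayPt β n)).det ≠ 0 := by
  rw [frameMat_det]
  obtain ⟨Pbox, Pd, -, P7, -⟩ := ptChk_sound hp hn
  exact cas3_ne_zero _ Pbox (by linarith) (by linarith) (pairChk_sound hpair hn)

end Summit.KontsevichZagierPeriods.Zeta5Search.RecordRay.Generic
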